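import Mathlib
import Summits.Ventures.PercRepro2.Defs
import Summits.Ventures.PercRepro2.Independence
import Summits.Ventures.PercRepro2.Harris
import Summits.Ventures.PercRepro2.Graph
import Summits.Ventures.PercRepro2.Exploration
import Summits.Ventures.PercRepro2.Events
import Summits.Ventures.PercRepro2.Induced
import Summits.Ventures.PercRepro2.BHK
import Summits.Ventures.PercRepro2.BHKEvents
import Summits.Ventures.PercRepro2.OneEdge
import Summits.Ventures.PercRepro2.RBRoot
import Summits.Ventures.PercRepro2.RBRootEdge
import Summits.Ventures.PercRepro2.RBRootEdgePin
import Summits.Ventures.PercRepro2.RBRootEdgeMain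
import Summits.Ventures.PercRepro2.RBRootIsolated
import Summits.Ventures.PercRepro2.RBTwoMarkers
import Summits.Ventures.PercRepro2.RBTwoMarkersMain
import Summits.Ventures.PercRepro2.RBTwoMarkersCross
import Summits.Ventures.PercRepro2.RBTwoMarkersCrossMain
import Summits.Ventures.PercRepro2.RBDefs
import Summits.Ventures.PercRepro2.RBClubDefs
import Summits.Ventures.PercRepro2.RBClubPoly
import Summits.Ventures.PercRepro2.RBClubTwoMarkers

/-!
# Candidate row 2′RB-CLUB at a third vertex adjacent only to the two markers — the theorem
(blind cell PercRepro2, mine-a g8; MINE-A.md §48–§49, proofs/MINEA-CLUB.md §7)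

`club_two_markers_of_zero`: with `e₁ = {w, b}`, `e₂ = {w, o}` the only edges of nonzero weight at
`w ∉ {s, t, b, o}`, the coarse row `RB.Club` holds at `w`. The seven masses are pinned over the
four patterns of `(e₁, e₂)` (`RBClubTwoMarkers`), which writes the cleared cubic as
`RBClubPoly.clubPoly` in the core masses `Z, A, C, J, H, K` of `G − w`; the certificate
`RBClubPoly.clubPoly_nonneg` (BHK 1.3 of `G − w` as the single multiplier `Δ = J·Z − A·C`) and
`RBClubPoly.club_of_cleared` finish.
-/

namespace Summit.Ventures.PercRepro2

namespace RBClubTwoMarkers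

open scoped Classical

section Main

variable {V : Type*} {E : Type*} [Fintype E] [DecidableEq E] [Fintype V] {R : Type*} [Field R]
  [LinearOrder R] [IsStrictOrderedRing R] (ends : E → Sym2 V) (s t w : V)

/-- **BHK 1.3, cleared**: `P(Q ∩ bL) P(Q ∩ oL) ≤ P(Q ∩ bL ∩ oL) P(Q)`. -/
lemma bhk_same_cleared {q : E → R} (hq : IsProbVec q) (b o : V) :
    prob q ((connEvent ends s t)ᶜ ∩ connEvent ends b s) *
        prob q ((connEvent ends s t)ᶜ ∩ connEvent ends o s) ≤
      prob q ((connEvent ends s t)ᶜ ∩ connEvent ends b s ∩ connEvent ends o s) *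
        prob q (connEvent ends s t)ᶜ := by
  have key := bhk_same_cluster_events q hq ends s t (RBRoot.isUpperSet_mem b) (RBRoot.isUpperSet_mem o)
  rw [← RBRoot.connEvent_eq_clusterInEvent_right ends b s,
    ← RBRoot.connEvent_eq_clusterInEvent_right ends o s] at key
  have e1 : connEvent ends b s ∩ (connEvent ends s t)ᶜ =
      (connEvent ends s t)ᶜ ∩ connEvent ends b s := Set.inter_comm _ _
  have e2 : connEvent ends o s ∩ (connEvent ends s t)ᶜ =
      (connEvent ends s t)ᶜ ∩ connEvent ends o s := Set.inter_comm _ _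
  have e3 : connEvent ends b s ∩ connEvent ends o s ∩ (connEvent ends s t)ᶜ =
      (connEvent ends s t)ᶜ ∩ connEvent ends b s ∩ connEvent ends o s := by
    ext ω; simp only [Set.mem_inter_iff]; tauto
  rw [e1, e2, e3] at key
  exact key

/-- **The coarse row at a third vertex adjacent only to the two markers** (`e₁ = {w, b}`,
`e₂ = {w, o}` the only edges of nonzero weight at `w`, `w ∉ {s, t, b, o}`): MINE-A.md §48. -/
theorem club_two_markers_of_zero {p : E → R} (hp : IsProbVec p) {e₁ e₂ : E} {b o : V}
    (hz : ∀ e, w ∈ ends e → e ≠ e₁ → e ≠ e₂ → p e = 0) (hends₁ : ends e₁ = s(w, b))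
    (hends₂ : ends e₂ = s(w, o)) (hne : e₁ ≠ e₂) (hws : s ≠ w) (hwt : t ≠ w) (hwb : b ≠ w)
    (hwo : o ≠ w) : RB.Club p ends o b s t w := by
  -- the four pattern laws
  have hz₂ : ∀ e, w ∈ ends e ∧ e ≠ e₁ → Function.update p e₂ 0 e = 0 := by
    rintro e ⟨he, hne₁⟩
    by_cases h : e = e₂
    · subst h; exact Function.update_self _ _ _
    · rw [Function.update_of_ne h]; exact hz e he hne₁ h
  have hz₁ : ∀ e, w ∈ ends e ∧ e ≠ e₂ → Function.update p e₁ 0 e = 0 := by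
    rintro e ⟨he, hne₂⟩
    by_cases h : e = e₁
    · subst h; exact Function.update_self _ _ _
    · rw [Function.update_of_ne h]; exact hz e he h hne₂
  have hz00 : ∀ e, w ∈ ends e → Function.update (Function.update p e₂ 0) e₁ 0 e = 0 := by
    intro e he
    by_cases h₁ : e = e₁
    · subst h₁; exact Function.update_self _ _ _
    · rw [Function.update_of_ne h₁]; exact hz₂ e ⟨he, h₁⟩
  have hp20 : IsProbVec (Function.update p e₂ 0) := hp.update e₂ le_rfl zero_le_one
  have hβ21 : Function.update p e₂ 1 e₁ = p e₁ := Function.update_of_ne hne _ _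
  have hβ20 : Function.update p e₂ 0 e₁ = p e₁ := Function.update_of_ne hne _ _
  have hcomm10 : Function.update (Function.update p e₂ 1) e₁ 0 =
      Function.update (Function.update p e₁ 0) e₂ 1 := Function.update_comm hne.symm _ _ _
  have hcomm11 : Function.update (Function.update p e₂ 1) e₁ 1 =
      Function.update (Function.update p e₁ 1) e₂ 1 := Function.update_comm hne.symm _ _ _
  -- abbreviations (events)
  set Q := (connEvent ends s t)ᶜ with hQ
  set M := connEvent ends s w with hM
  set bL := connEvent ends b s with hbL
  set oL := connEvent ends o s with hoL
  set oH := connEvent ends o t with hoH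
  set bH := connEvent ends b t with hbH
  -- leaf invariances: the core events under the patterns are those of `G − w`
  obtain ⟨L1a, L1b, L1c, -, L1d, L1e⟩ := RBTwoMarkers.prob_leaf_update_events ends w
    (Function.update p e₂ 0) hz₂ hends₁ s t b o hws hwt hwb hwo 1 (Or.inr rfl)
  obtain ⟨L0a, L0b, L0c, -, L0d, L0e⟩ := RBTwoMarkers.prob_leaf_update_events ends w
    (Function.update p e₂ 0) hz₂ hends₁ s t b o hws hwt hwb hwo 0 (Or.inl rfl)
  obtain ⟨-, -, -, -, -, L0g⟩ := RBTwoMarkers.prob_leaf_update_events ends w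
    (Function.update p e₂ 0) hz₂ hends₁ s t o b hws hwt hwo hwb 0 (Or.inl rfl)
  obtain ⟨L01a, L01b, L01c, -, L01d, -⟩ := RBTwoMarkers.prob_leaf_update_events ends w
    (Function.update p e₁ 0) hz₁ hends₂ s t b o hws hwt hwb hwo 1 (Or.inr rfl)
  obtain ⟨L00a, L00b, L00c, -, L00d, -⟩ := RBTwoMarkers.prob_leaf_update_events ends w
    (Function.update p e₁ 0) hz₁ hends₂ s t b o hws hwt hwb hwo 0 (Or.inl rfl)
  rw [← hcomm10] at L01a L01b L01c L01d
  rw [Function.update_comm hne] at L00a L00b L00c L00d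
  -- the core masses of `G − w`
  set Z := prob (Function.update p e₂ 0) Q with hZ
  set A := prob (Function.update p e₂ 0) (Q ∩ bL) with hA
  set C := prob (Function.update p e₂ 0) (Q ∩ oL) with hC
  set J := prob (Function.update p e₂ 0) (Q ∩ bL ∩ oL) with hJ
  set H := prob (Function.update p e₂ 0) (Q ∩ bL ∩ oH) with hH
  set K := prob (Function.update p e₂ 0) (Q ∩ oL ∩ bH) with hK
  -- `P₀₁` sees `G − w`
  have E01a : prob (Function.update (Function.update p e₂ 1) e₁ 0) Q = Z := by
    rw [L01a, ← L00a, L0a]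
  have E01b : prob (Function.update (Function.update p e₂ 1) e₁ 0) (Q ∩ bL) = A := by
    rw [L01b, ← L00b, L0b]
  have E01c : prob (Function.update (Function.update p e₂ 1) e₁ 0) (Q ∩ oL) = C := by
    rw [L01c, ← L00c, L0c]
  have E01d : prob (Function.update (Function.update p e₂ 1) e₁ 0) (Q ∩ bL ∩ oL) = J := by
    rw [L01d, ← L00d, L0d]
  -- set identities
  have e00 : Q ∩ M ∩ bL ∩ oL = Q ∩ bL ∩ oL ∩ M := by ac_rfl
  have e00b : Q ∩ Mᶜ ∩ bL = Q ∩ bL ∩ Mᶜ := Set.inter_right_comm _ _ _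
  have e00c : Q ∩ Mᶜ ∩ oL = Q ∩ oL ∩ Mᶜ := Set.inter_right_comm _ _ _
  have e10 : Q ∩ M ∩ bL ∩ oL = Q ∩ M ∩ (bL ∩ oL) := Set.inter_assoc _ _ _
  have e10' : Q ∩ bL ∩ (bL ∩ oL) = Q ∩ bL ∩ oL := by
    ext ω
    simp only [Set.mem_inter_iff]
    exact ⟨fun ⟨⟨hQ', hb⟩, _, ho⟩ => ⟨⟨hQ', hb⟩, ho⟩, fun ⟨⟨hQ', hb⟩, ho⟩ => ⟨⟨hQ', hb⟩, hb, ho⟩⟩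
  have e01' : Q ∩ oL ∩ (bL ∩ oL) = Q ∩ bL ∩ oL := by
    ext ω
    simp only [Set.mem_inter_iff]
    exact ⟨fun ⟨⟨hQ', ho⟩, hb, _⟩ => ⟨⟨hQ', hb⟩, ho⟩, fun ⟨⟨hQ', hb⟩, ho⟩ => ⟨⟨hQ', ho⟩, hb, ho⟩⟩
  have ebb : Q ∩ bLᶜ ∩ bL = ∅ :=
    Set.eq_empty_iff_forall_notMem.2 fun ω ⟨⟨_, h⟩, h'⟩ => h h'
  have eoo : Q ∩ oLᶜ ∩ oL = ∅ :=
    Set.eq_empty_iff_forall_notMem.2 fun ω ⟨⟨_, h⟩, h'⟩ => h h'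
  -- pattern (0,0): `w` isolated
  have M00 : prob (Function.update (Function.update p e₂ 0) e₁ 0) (Q ∩ M ∩ bL ∩ oL) = 0 := by
    rw [e00]; exact prob_inter_conn_eq_zero_of_closed ends s w _ hz00 hws _
  have B00 : prob (Function.update (Function.update p e₂ 0) e₁ 0) (Q ∩ Mᶜ ∩ bL) = A := by
    rw [e00b, prob_inter_compl_conn_eq_of_closed ends s w _ hz00 hws, L0b]
  have O00 : prob (Function.update (Function.update p e₂ 0) e₁ 0) (Q ∩ Mᶜ ∩ oL) = C := by
    rw [e00c, prob_inter_compl_conn_eq_of_closed ends s w _ hz00 hws, L0c]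
  have D00 : prob (Function.update (Function.update p e₂ 0) e₁ 0) (Q ∩ Mᶜ) = Z := by
    rw [prob_inter_compl_conn_eq_of_closed ends s w _ hz00 hws, L0a]
  -- pattern (1,0): `e₁` open, `{s ↔ w} = {b ↔ s}`
  have M10 : prob (Function.update (Function.update p e₂ 0) e₁ 1) (Q ∩ M ∩ bL ∩ oL) = J := by
    rw [e10, prob_update_one_inter_conn_eq ends s w _ hends₁, e10', L1d]
  have B10 : prob (Function.update (Function.update p e₂ 0) e₁ 1) (Q ∩ Mᶜ ∩ bL) = 0 := by
    rw [prob_update_one_inter_compl_conn_eq ends s w _ hends₁, ebb, prob_empty]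
  have O10 : prob (Function.update (Function.update p e₂ 0) e₁ 1) (Q ∩ Mᶜ ∩ oL) = C - J := by
    rw [prob_update_one_inter_compl_conn_eq ends s w _ hends₁, Set.inter_right_comm]
    have h := prob_inter_add_prob_inter_compl (Function.update (Function.update p e₂ 0) e₁ 1)
      (Q ∩ oL) bL
    rw [Set.inter_right_comm Q oL bL, L1d, L1c] at h
    linarith
  have D10 : prob (Function.update (Function.update p e₂ 0) e₁ 1) (Q ∩ Mᶜ) = Z - A := by
    have h := prob_update_one_inter_compl_conn_eq ends s w (Function.update p e₂ 0) hends₁ Q Set.univ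
    rw [Set.inter_univ, Set.inter_univ] at h
    rw [h]
    have h' := prob_inter_add_prob_inter_compl (Function.update (Function.update p e₂ 0) e₁ 1) Q bL
    rw [L1a, L1b] at h'
    linarith
  -- pattern (0,1): `e₂` open, `{s ↔ w} = {o ↔ s}`
  have M01 : prob (Function.update (Function.update p e₂ 1) e₁ 0) (Q ∩ M ∩ bL ∩ oL) = J := by
    rw [e10, hcomm10, prob_update_one_inter_conn_eq ends s w _ hends₂, e01', ← hcomm10, E01d]
  have B01 : prob (Function.update (Function.update p e₂ 1) e₁ 0) (Q ∩ Mᶜ ∩ bL) = A - J := by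
    rw [hcomm10, prob_update_one_inter_compl_conn_eq ends s w _ hends₂, Set.inter_right_comm,
      ← hcomm10]
    have h := prob_inter_add_prob_inter_compl (Function.update (Function.update p e₂ 1) e₁ 0)
      (Q ∩ bL) oL
    rw [E01d, E01b] at h
    linarith
  have O01 : prob (Function.update (Function.update p e₂ 1) e₁ 0) (Q ∩ Mᶜ ∩ oL) = 0 := by
    rw [hcomm10, prob_update_one_inter_compl_conn_eq ends s w _ hends₂, eoo, prob_empty]
  have D01 : prob (Function.update (Function.update p e₂ 1) e₁ 0) (Q ∩ Mᶜ) = Z - C := by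
    have h := prob_update_one_inter_compl_conn_eq ends s w (Function.update p e₁ 0) hends₂ Q Set.univ
    rw [Set.inter_univ, Set.inter_univ, ← hcomm10] at h
    rw [h]
    have h' := prob_inter_add_prob_inter_compl (Function.update (Function.update p e₂ 1) e₁ 0) Q oL
    rw [E01a, E01c] at h'
    linarith
  -- pattern (1,1): both open, `b ≡ o` through `w`
  have hX : Q ∩ (bL ∩ oH) ∩ (oL ∩ bH) = ∅ := by
    refine Set.eq_empty_iff_forall_notMem.2 fun ω hω => ?_
    obtain ⟨⟨hQ', hbs, _⟩, _, hbt⟩ := hω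
    exact (Set.eq_empty_iff_forall_notMem.1 (compl_inter_conn_inter_conn ends s t b)) ω
      ⟨⟨hQ', hbs⟩, hbt⟩
  have Z11 : prob (Function.update (Function.update p e₂ 1) e₁ 1) Q = Z - H - K := by
    rw [prob_both_open_compl ends s t w p hz hends₁ hends₂ hne hws hwt hwo, prob_inter_compl_compl,
      hX, prob_empty, ← Set.inter_assoc, ← Set.inter_assoc, L0a, L0e, L0g]
    ring
  have X11 : prob (Function.update (Function.update p e₂ 1) e₁ 1) (Q ∩ bL) = A + C - J - H - K := by
    rw [prob_both_open_conn ends s t w p hz hends₁ hends₂ hne hws hwt hwb hwo]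
    have e1 : Q ∩ (bL ∩ oH)ᶜ ∩ (oL ∩ bH)ᶜ ∩ (bL ∪ oL) =
        Q ∩ (bL ∪ oL) ∩ (bL ∩ oH)ᶜ ∩ (oL ∩ bH)ᶜ := by ac_rfl
    have e2 : Q ∩ (bL ∪ oL) ∩ (bL ∩ oH) = Q ∩ bL ∩ oH := by
      ext ω
      simp only [Set.mem_inter_iff, Set.mem_union]
      exact ⟨fun ⟨⟨hQ', _⟩, hb, ho⟩ => ⟨⟨hQ', hb⟩, ho⟩,
        fun ⟨⟨hQ', hb⟩, ho⟩ => ⟨⟨hQ', Or.inl hb⟩, hb, ho⟩⟩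
    have e3 : Q ∩ (bL ∪ oL) ∩ (oL ∩ bH) = Q ∩ oL ∩ bH := by
      ext ω
      simp only [Set.mem_inter_iff, Set.mem_union]
      exact ⟨fun ⟨⟨hQ', _⟩, ho, hb⟩ => ⟨⟨hQ', ho⟩, hb⟩,
        fun ⟨⟨hQ', ho⟩, hb⟩ => ⟨⟨hQ', Or.inr ho⟩, ho, hb⟩⟩
    have e4 : Q ∩ bL ∩ oH ∩ (oL ∩ bH) = ∅ := by
      refine Set.eq_empty_iff_forall_notMem.2 fun ω hω => ?_
      obtain ⟨⟨⟨hQ', hbs⟩, _⟩, _, hbt⟩ := hω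
      exact (Set.eq_empty_iff_forall_notMem.1 (compl_inter_conn_inter_conn ends s t b)) ω
        ⟨⟨hQ', hbs⟩, hbt⟩
    have e5 : Q ∩ (bL ∪ oL) = (Q ∩ bL) ∪ (Q ∩ oL) := Set.inter_union_distrib_left _ _ _
    have e6 : (Q ∩ bL) ∩ (Q ∩ oL) = Q ∩ bL ∩ oL := by
      ext ω
      simp only [Set.mem_inter_iff]
      exact ⟨fun ⟨⟨hQ', hb⟩, _, ho⟩ => ⟨⟨hQ', hb⟩, ho⟩, fun ⟨⟨hQ', hb⟩, ho⟩ => ⟨⟨hQ', hb⟩, hQ', ho⟩⟩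
    have hu := prob_union_add_prob_inter (Function.update (Function.update p e₂ 0) e₁ 0) (Q ∩ bL)
      (Q ∩ oL)
    rw [e6, L0b, L0c, L0d] at hu
    rw [e1, prob_inter_compl_compl, e2, e3, e4, prob_empty, e5, L0e, L0g]
    linarith
  obtain ⟨hBO, hOO⟩ := RBTwoMarkers.prob_both_open ends s t w p hends₁ hends₂ hne
  have O11 : prob (Function.update (Function.update p e₂ 1) e₁ 1) (Q ∩ oL) = A + C - J - H - K := by
    rw [hOO, ← hBO, X11]
  have M11 : prob (Function.update (Function.update p e₂ 1) e₁ 1) (Q ∩ M ∩ bL ∩ oL) =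
      A + C - J - H - K := by
    rw [e10, prob_update_one_inter_conn_eq ends s w _ hends₁, e10', ← hBO, X11]
  have B11 : prob (Function.update (Function.update p e₂ 1) e₁ 1) (Q ∩ Mᶜ ∩ bL) = 0 := by
    rw [prob_update_one_inter_compl_conn_eq ends s w _ hends₁, ebb, prob_empty]
  have O11' : prob (Function.update (Function.update p e₂ 1) e₁ 1) (Q ∩ Mᶜ ∩ oL) = 0 := by
    rw [hcomm11, prob_update_one_inter_compl_conn_eq ends s w _ hends₂, eoo, prob_empty]
  have D11 : prob (Function.update (Function.update p e₂ 1) e₁ 1) (Q ∩ Mᶜ) =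
      (Z - H - K) - (A + C - J - H - K) := by
    have h := prob_update_one_inter_conn_eq ends s w (Function.update p e₂ 1) hends₁ Q Set.univ
    rw [Set.inter_univ, Set.inter_univ] at h
    have h' := prob_inter_add_prob_inter_compl (Function.update (Function.update p e₂ 1) e₁ 1) Q M
    rw [h, X11, Z11] at h'
    linarith
  -- the seven masses of `p` as mixtures
  have pin : ∀ S : Set (Config E), prob p S =
      p e₂ * (p e₁ * prob (Function.update (Function.update p e₂ 1) e₁ 1) S +
        (1 - p e₁) * prob (Function.update (Function.update p e₂ 1) e₁ 0) S) +
      (1 - p e₂) * (p e₁ * prob (Function.update (Function.update p e₂ 0) e₁ 1) S +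
        (1 - p e₁) * prob (Function.update (Function.update p e₂ 0) e₁ 0) S) := by
    intro S
    rw [prob_eq_pin p S e₂, prob_eq_pin (Function.update p e₂ 1) S e₁,
      prob_eq_pin (Function.update p e₂ 0) S e₁, hβ21, hβ20]
  have h1 := pin Q
  have h2 := pin (Q ∩ M ∩ bL ∩ oL)
  have h3 := pin (Q ∩ bL)
  have h4 := pin (Q ∩ oL)
  have h5 := pin (Q ∩ Mᶜ)
  have h6 := pin (Q ∩ Mᶜ ∩ bL)
  have h7 := pin (Q ∩ Mᶜ ∩ oL)
  rw [Z11, E01a, L1a, L0a] at h1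
  rw [M11, M01, M10, M00] at h2
  rw [X11, E01b, L1b, L0b] at h3
  rw [O11, E01c, L1c, L0c] at h4
  rw [D11, D01, D10, D00] at h5
  rw [B11, B01, B10, B00] at h6
  rw [O11', O01, O10, O00] at h7
  -- the constraints of the certificate
  have hJ0 : 0 ≤ J := prob_nonneg hp20 _
  have hH0 : 0 ≤ H := prob_nonneg hp20 _
  have hK0 : 0 ≤ K := prob_nonneg hp20 _
  have hl : 0 ≤ A - J - H := by
    have h := prob_inter_compl_compl (Function.update p e₂ 0) (Q ∩ bL) oL oH
    have e : Q ∩ bL ∩ oL ∩ oH = ∅ := by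
      refine Set.eq_empty_iff_forall_notMem.2 fun ω hω => ?_
      obtain ⟨⟨⟨hQ', _⟩, hos⟩, hot⟩ := hω
      exact (Set.eq_empty_iff_forall_notMem.1 (compl_inter_conn_inter_conn ends s t o)) ω
        ⟨⟨hQ', hos⟩, hot⟩
    rw [e, prob_empty] at h
    have := prob_nonneg hp20 (Q ∩ bL ∩ oLᶜ ∩ oHᶜ)
    linarith
  have hn : 0 ≤ C - J - K := by
    have h := prob_inter_compl_compl (Function.update p e₂ 0) (Q ∩ oL) bL bH
    have e : Q ∩ oL ∩ bL ∩ bH = ∅ := by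
      refine Set.eq_empty_iff_forall_notMem.2 fun ω hω => ?_
      obtain ⟨⟨⟨hQ', _⟩, hbs⟩, hbt⟩ := hω
      exact (Set.eq_empty_iff_forall_notMem.1 (compl_inter_conn_inter_conn ends s t b)) ω
        ⟨⟨hQ', hbs⟩, hbt⟩
    rw [e, prob_empty, Set.inter_right_comm Q oL bL] at h
    have := prob_nonneg hp20 (Q ∩ oL ∩ bLᶜ ∩ bHᶜ)
    linarith
  have hr : 0 ≤ Z - A - C + J := by
    have h := prob_inter_compl_compl (Function.update p e₂ 0) Q bL oL
    have := prob_nonneg hp20 (Q ∩ bLᶜ ∩ oLᶜ)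
    linarith
  have hΔ : 0 ≤ J * Z - A * C := by
    have := bhk_same_cleared ends s t hp20 b o
    linarith
  -- the cleared cubic is the certified polynomial
  refine RBClubPoly.club_of_cleared ends hp o b s t w ?_
  rw [h1, h2, h3, h4, h5, h6, h7]
  have key := RBClubPoly.clubPoly_nonneg hJ0 hH0 hK0 hl hn hr hΔ (hp.nonneg e₁) (hp.le_one e₁)
    (hp.nonneg e₂) (hp.le_one e₂)
  convert key using 1
  unfold RBClubPoly.clubPoly
  ring

end Main

end RBClubTwoMarkers

end Summit.Ventures.PercRepro2
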